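import Summits.BirchSwinnertonDyer.BirchSwinnertonDyer.Theorems.AdditiveRankOneBSDpRowKernels
import Summits.BirchSwinnertonDyer.BirchSwinnertonDyer.Theorems.AdditivePotSupersingularControlOfFacts
import HarnessLib

/-!
# The two HALVES of BSD_p in analytic rank ONE at an additive prime, ROW-LOCAL, and on the potentially supersingular
# rows with control discharged: LOWER half ⟸ Eisenstein ♭-inclusion + the twist's r = 0 UPPER half; UPPER half ⟸
# Kolyvagin index bound + the twist's r = 0 LOWER half (K9 19200 `WildRankOne` / KT 19984 `TameRankOne`; row B8 O7-ss)

Prover seat `bsd-potss-kmc`, gen 20 (cell `bsd-potss`), 2026-08-27. HONEST FRAMING: CONDITIONAL on every displayed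
hypothesis; 0 definitions, 0 named facts minted, 0 `sorry`; closes nothing; BSD_p for no curve.

The routes K9/KT split their rank-ZERO conjunct into halves (`WildLowerHalfRankZero` L₀ = `MissingLowerBoundAt`, research;
U₀ = `MissingUpperBoundAt`, derived/settled by citation modulo crux M) but carry the rank-ONE conjunct whole
(`WildRankOne` 19200 / `TameRankOne` 19984: `MissingPPartAt`, declared residual). This file gives the rank-one conjunct
the SAME half structure, row-locally at any odd additive prime and with the local step discharged on the potentially
supersingular X4 rows, through the Gross–Zagier bookkeeping over the pair `(E, E^{(d_K)})` (kmc g17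
`SchneiderFree.Exact.jointLowerBoundAt_of_stepL_manin`, K1's `SchneiderFree.Upper.jointUpperBoundAt_of_coStepL_manin`,
`Typed.missingLowerBoundAt_of_joint_of_upper`, `Upper.missingUpperBoundAt_of_jointUpper_of_lower`):

* §1 `missingLowerBoundAt_of_indexLower_of_twistUpper_row` — ONE `W` (`Addv W p`, `r_an = 1`): STEP L
  `IndexLowerBoundLeAt W p K P (v_p c)` at every Heegner datum with `d_K` odd `< −4` + the r = 0 UPPER half
  `MissingUpperBoundAt` of the twists ⟹ the r = 1 LOWER half `MissingLowerBoundAt W p`;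
  `missingUpperBoundAt_of_indexUpper_of_twistLower_row` — co-STEP L + the twists' r = 0 LOWER half ⟹ the r = 1 UPPER
  half `MissingUpperBoundAt W p` (NO `p`-adic input at all: the type-blind Heegner-index chain, row-local).
* §2 `missingLowerBoundAt_of_flatEisenstein_of_control_of_twistUpper_row` — the r = 1 LOWER half from the Eisenstein
  ♭-inclusion `Ch_Λ(X_(∅,0))·𝓞_{ℂ_p}⟦T⟧ ⊆ (Q)` (X) + exact control + Hsieh/LZZ (value) + the twists' r = 0 UPPER half.
* §3 **`missingLowerBoundAt_potSS_rankOne_of_flatEisenstein_of_twistUpper_of_facts`** `(p) (R)` — on the rows `R W`,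
  `ClassO5 W p ∨ ClassO6 W p`, `ρ̄_{E,p}` irreducible, `r_an = 1`: the r = 1 LOWER half ⟸ X on the class rows + the r = 0
  UPPER half of the class rows' twists + the seven cohomological facts + Hsieh + LZZ + published inputs — control supplied
  by `additiveControl_heegner_potSS_of_facts_of_serre1967`. At the wild `3` the twist's r = 0 upper half is K9's U₀
  (DERIVED: settled by citation modulo crux M), so on the wild X4 rank-one rows the LOWER half of 19200 reduces to route
  SOED's crux X `WildSplitEisensteinInclusionAtThree` ALONE (♭-currency) plus print; the UPPER half of 19200 reduces to a
  Manin-robust Kolyvagin index bound (SOED Ko/J) plus K9's L₀ on the twist — no `p`-adic input.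

References: [GrossZagier1986] I.(6.3), Thm. I.7.3; [JetchevSkinnerWan2017] §7.4.1, Thm. 3.3.1; [Hsieh2014] Thm A;
[LiuZhangZhang2018] Thm 1.5.1/1.5.3; [FriedbergHoffstein1995] Thm. B; [Miller2011LMS] Def. 1.1; [Brink2007] Thm 2, Cor 1;
[Serre1967GroupesPDivisibles] §5 Prop. 8.
-/

noncomputable section

open scoped Classical

set_option linter.dupNamespace false
set_option autoImplicit false

namespace Summit.BirchSwinnertonDyer.BirchSwinnertonDyer.Theorems.UniversalToricDescentWaldspurgerFlat

open WeierstrassCurve NumberField IsDedekindDomain Field PowerSeries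
  Literature.NumberTheory.EllipticCurves
  Literature.NumberTheory.EllipticCurves.ModularForms
  Literature.NumberTheory.EllipticCurves.Rank1Residual
  Literature.NumberTheory.EllipticCurves.Rank1Residual.Typed
  Literature.NumberTheory.EllipticCurves.KrizLi2019
  Literature.NumberTheory.GaloisRepresentations
  Literature.NumberTheory.GaloisCohomology
  Summit.BirchSwinnertonDyer.Rank1Residual
  Summit.BirchSwinnertonDyer.Rank1Residual.Additive
  Summit.BirchSwinnertonDyer.Rank1Residual.X11b
  Summit.BirchSwinnertonDyer.Rank1Residual.X11b.AcSelmer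
  Summit.BirchSwinnertonDyer.Rank1Residual.X11b.Halves
  Summit.BirchSwinnertonDyer.Rank1Residual.X11b.CongruenceLimit
  Summit.BirchSwinnertonDyer.BirchSwinnertonDyer.Theses.UniversalToricDescent
  Summit.BirchSwinnertonDyer.BirchSwinnertonDyer.Theorems.AdditivePotSupersingularControl

/-! ## §1 Row-local half kernels on the index sockets -/

/-- **The r = 1 LOWER half from STEP L and the twists' r = 0 UPPER half — ROW-LOCAL, any odd additive `p`.** For one
globally minimal `W` additive at the odd `p` with `r_an = 1`: IF at every Heegner datum of `W` over an imaginary quadratic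
Heegner field with `d_K` odd, `d_K < −4`, `L(E^{(d_K)},1) ≠ 0`, `P` the non-torsion Heegner point,
`IndexLowerBoundLeAt W p K P (v_p c)` holds, and every globally minimal model `Wd` of such a twist satisfies
`MissingUpperBoundAt Wd p`, THEN `MissingLowerBoundAt W p` (parity, Friedberg–Hoffstein with `2`, `3` split, Gross–Zagier
non-torsion, kmc g17's `jointLowerBoundAt_of_stepL_manin`, then `missingLowerBoundAt_of_joint_of_upper`). CONDITIONAL.
[cite: GrossZagier1986, I.(6.3) and Thm. I.7.3] [cite: JetchevSkinnerWan2017, §7.4.1 (arXiv:1512.06894 p. 30)]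
[cite: FriedbergHoffstein1995, Thm. B] [cite: Miller2011LMS, Def. 1.1 (arXiv:1010.2431 p. 3)] -/
theorem missingLowerBoundAt_of_indexLower_of_twistUpper_row (p : ℕ) [Fact p.Prime] (hp2 : p ≠ 2) (hF : ToricPublishedInputs)
    (W : WeierstrassCurve ℚ) [W.IsElliptic] [W.IsGloballyMinimal] (haddv : Addv W p) (hr : W.analyticRank = 1)
    (hLoI : ∀ (N : ℕ) [NeZero N] (K : Type) [Field K] [NumberField K] (Dt : ModularParametrizationData W N)
      (H : HeegnerDatum N (NumberField.discr K)) (ι : K →+* ℂ) (P : (W.baseChange K).toAffine.Point),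
      W.conductorNorm ℤ = N → IsImaginaryQuadratic K → SatisfiesHeegnerHypothesis N K → Odd (NumberField.discr K) →
      NumberField.discr K < -4 → (W.quadraticTwist (NumberField.discr K : ℚ)).entireLFunction 1 ≠ 0 →
      WeierstrassCurve.Affine.Point.map ι.toRatAlgHom P = heegnerPointComplex Dt H → ¬ IsOfFinAddOrder P →
      SchneiderFree.IndexLowerBoundLeAt W p K P (padicValNat p Dt.c.natAbs))
    (hTwUp : ∀ (N : ℕ) [NeZero N] (K : Type) [Field K] [NumberField K]
      (Wd : WeierstrassCurve ℚ) [Wd.IsElliptic] [Wd.IsGloballyMinimal],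
      W.conductorNorm ℤ = N → IsImaginaryQuadratic K → SatisfiesHeegnerHypothesis N K →
      (∃ C : VariableChange ℚ, C • W.quadraticTwist (NumberField.discr K : ℚ) = Wd) →
      (W.quadraticTwist (NumberField.discr K : ℚ)).entireLFunction 1 ≠ 0 → MissingUpperBoundAt Wd p) :
    MissingLowerBoundAt W p := by
  have hp : p.Prime := Fact.out
  obtain ⟨hGZ, hKo, hGZK, hmod, hmodP, -, hGZ73, hFH, hpar, hHP⟩ := hF
  haveI hN0 : NeZero (W.conductorNorm ℤ) := ⟨W.conductorNorm_pos_holds.ne'⟩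
  have hw : W.rootNumber = -1 := by
    rcases W.rootNumber_eq_one_or with h | h
    · exfalso
      have heven : Even W.analyticRank := (hpar W).mpr h
      rw [hr] at heven
      exact Nat.not_even_one heven
    · exact h
  obtain ⟨K, _, _, hK, -, hHN, hH6, hLt⟩ := hFH W hw 6 (by norm_num) 0
  have hodd : Odd (NumberField.discr K) := by
    have h8 := Literature.SatisfiesHeegnerHypothesis.discr_emod_eight hK.1 hH6 (by norm_num : (2 : ℕ) ∣ 6)
    rw [Int.odd_iff]; omega
  have hd4 : NumberField.discr K < -4 :=
    discr_lt_neg_four_of_three_split hK (hH6 3 Nat.prime_three (by norm_num : (3 : ℕ) ∣ 6))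
  have hwK : ¬ p ∣ Units.torsionOrder K := by
    rw [Literature.NumberTheory.QuadraticFields.Quadratic.torsionOrder_eq_two_of_discr_lt_neg_four hK.1 hd4]
    intro h
    exact hp2 ((Nat.prime_dvd_prime_iff_eq hp Nat.prime_two).mp h)
  have hpN : p ∣ W.conductorNorm ℤ :=
    (W.dvd_conductorNorm_iff_not_hasGoodReductionAtPrime p).mpr (not_good_of_addv W p haddv)
  obtain ⟨P, Dt, H, ι, hP⟩ := hHP W K hK hHN
  have hL0 : W.entireLFunction 1 = 0 := entireLFunction_one_eq_zero_of_analyticRank_eq_one hr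
  obtain ⟨-, hderiv⟩ := leadingLCoeff_eq_deriv_of_analyticRank_eq_one hr
  have hLK : LDerivEK W K ≠ 0 := by
    rw [lDerivEK_eq_deriv_mul W K hmod hL0]; exact mul_ne_zero hderiv hLt
  have hnt : ¬ IsOfFinAddOrder P :=
    (lDerivEK_ne_zero_iff_not_isOfFinAddOrder W (W.conductorNorm ℤ) K (hGZ _ W K) hK hHN
      ⟨Dt, H, ι, hP⟩).mp hLK
  have hlo : SchneiderFree.IndexLowerBoundLeAt W p K P (padicValNat p Dt.c.natAbs) :=
    hLoI (W.conductorNorm ℤ) K Dt H ι P rfl hK hHN hodd hd4 hLt hP hnt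
  have hD0 : (NumberField.discr K : ℚ) ≠ 0 := by exact_mod_cast NumberField.discr_ne_zero K
  haveI : (W.quadraticTwist (NumberField.discr K : ℚ)).IsElliptic := W.isElliptic_quadraticTwist hD0
  obtain ⟨Cd, hCd⟩ := hasGlobalMinimalModel_rat_holds (W.quadraticTwist (NumberField.discr K : ℚ))
  haveI : (Cd • W.quadraticTwist (NumberField.discr K : ℚ)).IsGloballyMinimal := hCd
  have hdup : MissingUpperBoundAt (Cd • W.quadraticTwist (NumberField.discr K : ℚ)) p :=
    hTwUp (W.conductorNorm ℤ) K (Cd • W.quadraticTwist (NumberField.discr K : ℚ)) rfl hK hHN ⟨Cd, rfl⟩ hLt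
  exact missingLowerBoundAt_of_joint_of_upper
    (SchneiderFree.Exact.jointLowerBoundAt_of_stepL_manin hGZ hKo hGZK hmod hGZ73 W p (W.conductorNorm ℤ) K Dt H ι P
      (Cd • W.quadraticTwist (NumberField.discr K : ℚ)) hr rfl hpN hK hodd hwK hHN hLt hP ⟨Cd, rfl⟩ hp2 hlo) hdup

/-- **The r = 1 UPPER half from co-STEP L and the twists' r = 0 LOWER half — ROW-LOCAL, any odd additive `p`; NO
`p`-adic input** (the type-blind Heegner-index chain): for one `W` additive at the odd `p` with `r_an = 1`, IF at every
Heegner datum as above `Upper.IndexUpperBoundLeAt W p K P (v_p c)` holds (Kolyvagin + Jetchev's direction, Manin-robust) and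
every globally minimal model `Wd` of such a twist satisfies `MissingLowerBoundAt Wd p`, THEN `MissingUpperBoundAt W p`
(K1's `Upper.jointUpperBoundAt_of_coStepL_manin`, then `Upper.missingUpperBoundAt_of_jointUpper_of_lower`). CONDITIONAL.
[cite: GrossZagier1986, I.(6.3) and Thm. I.7.3] [cite: JetchevSkinnerWan2017, §7.4.1 (arXiv:1512.06894 p. 30)]
[cite: FriedbergHoffstein1995, Thm. B] [cite: Miller2011LMS, Def. 1.1 (arXiv:1010.2431 p. 3)] -/
theorem missingUpperBoundAt_of_indexUpper_of_twistLower_row (p : ℕ) [Fact p.Prime] (hp2 : p ≠ 2)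
    (hF : ToricPublishedInputs)
    (W : WeierstrassCurve ℚ) [W.IsElliptic] [W.IsGloballyMinimal] (haddv : Addv W p) (hr : W.analyticRank = 1)
    (hUpI : ∀ (N : ℕ) [NeZero N] (K : Type) [Field K] [NumberField K] (Dt : ModularParametrizationData W N)
      (H : HeegnerDatum N (NumberField.discr K)) (ι : K →+* ℂ) (P : (W.baseChange K).toAffine.Point),
      W.conductorNorm ℤ = N → IsImaginaryQuadratic K → SatisfiesHeegnerHypothesis N K → Odd (NumberField.discr K) →
      NumberField.discr K < -4 → (W.quadraticTwist (NumberField.discr K : ℚ)).entireLFunction 1 ≠ 0 →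
      WeierstrassCurve.Affine.Point.map ι.toRatAlgHom P = heegnerPointComplex Dt H → ¬ IsOfFinAddOrder P →
      SchneiderFree.Upper.IndexUpperBoundLeAt W p K P (padicValNat p Dt.c.natAbs))
    (hTwLo : ∀ (N : ℕ) [NeZero N] (K : Type) [Field K] [NumberField K]
      (Wd : WeierstrassCurve ℚ) [Wd.IsElliptic] [Wd.IsGloballyMinimal],
      W.conductorNorm ℤ = N → IsImaginaryQuadratic K → SatisfiesHeegnerHypothesis N K →
      (∃ C : VariableChange ℚ, C • W.quadraticTwist (NumberField.discr K : ℚ) = Wd) →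
      (W.quadraticTwist (NumberField.discr K : ℚ)).entireLFunction 1 ≠ 0 → MissingLowerBoundAt Wd p) :
    MissingUpperBoundAt W p := by
  have hp : p.Prime := Fact.out
  obtain ⟨hGZ, hKo, hGZK, hmod, hmodP, -, hGZ73, hFH, hpar, hHP⟩ := hF
  haveI hN0 : NeZero (W.conductorNorm ℤ) := ⟨W.conductorNorm_pos_holds.ne'⟩
  have hw : W.rootNumber = -1 := by
    rcases W.rootNumber_eq_one_or with h | h
    · exfalso
      have heven : Even W.analyticRank := (hpar W).mpr h
      rw [hr] at heven
      exact Nat.not_even_one heven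
    · exact h
  obtain ⟨K, _, _, hK, -, hHN, hH6, hLt⟩ := hFH W hw 6 (by norm_num) 0
  have hodd : Odd (NumberField.discr K) := by
    have h8 := Literature.SatisfiesHeegnerHypothesis.discr_emod_eight hK.1 hH6 (by norm_num : (2 : ℕ) ∣ 6)
    rw [Int.odd_iff]; omega
  have hd4 : NumberField.discr K < -4 :=
    discr_lt_neg_four_of_three_split hK (hH6 3 Nat.prime_three (by norm_num : (3 : ℕ) ∣ 6))
  have hwK : ¬ p ∣ Units.torsionOrder K := by
    rw [Literature.NumberTheory.QuadraticFields.Quadratic.torsionOrder_eq_two_of_discr_lt_neg_four hK.1 hd4]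
    intro h
    exact hp2 ((Nat.prime_dvd_prime_iff_eq hp Nat.prime_two).mp h)
  have hpN : p ∣ W.conductorNorm ℤ :=
    (W.dvd_conductorNorm_iff_not_hasGoodReductionAtPrime p).mpr (not_good_of_addv W p haddv)
  obtain ⟨P, Dt, H, ι, hP⟩ := hHP W K hK hHN
  have hL0 : W.entireLFunction 1 = 0 := entireLFunction_one_eq_zero_of_analyticRank_eq_one hr
  obtain ⟨-, hderiv⟩ := leadingLCoeff_eq_deriv_of_analyticRank_eq_one hr
  have hLK : LDerivEK W K ≠ 0 := by
    rw [lDerivEK_eq_deriv_mul W K hmod hL0]; exact mul_ne_zero hderiv hLt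
  have hnt : ¬ IsOfFinAddOrder P :=
    (lDerivEK_ne_zero_iff_not_isOfFinAddOrder W (W.conductorNorm ℤ) K (hGZ _ W K) hK hHN
      ⟨Dt, H, ι, hP⟩).mp hLK
  have hupI : SchneiderFree.Upper.IndexUpperBoundLeAt W p K P (padicValNat p Dt.c.natAbs) :=
    hUpI (W.conductorNorm ℤ) K Dt H ι P rfl hK hHN hodd hd4 hLt hP hnt
  have hD0 : (NumberField.discr K : ℚ) ≠ 0 := by exact_mod_cast NumberField.discr_ne_zero K
  haveI : (W.quadraticTwist (NumberField.discr K : ℚ)).IsElliptic := W.isElliptic_quadraticTwist hD0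
  obtain ⟨Cd, hCd⟩ := hasGlobalMinimalModel_rat_holds (W.quadraticTwist (NumberField.discr K : ℚ))
  haveI : (Cd • W.quadraticTwist (NumberField.discr K : ℚ)).IsGloballyMinimal := hCd
  have hdlo : MissingLowerBoundAt (Cd • W.quadraticTwist (NumberField.discr K : ℚ)) p :=
    hTwLo (W.conductorNorm ℤ) K (Cd • W.quadraticTwist (NumberField.discr K : ℚ)) rfl hK hHN ⟨Cd, rfl⟩ hLt
  exact SchneiderFree.Upper.missingUpperBoundAt_of_jointUpper_of_lower
    (SchneiderFree.Upper.jointUpperBoundAt_of_coStepL_manin hGZ hKo hGZK hmod hGZ73 W p (W.conductorNorm ℤ) K Dt H ι P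
      (Cd • W.quadraticTwist (NumberField.discr K : ℚ)) hr rfl hpN hK hodd hwK hHN hLt hP ⟨Cd, rfl⟩ hp2 hupI) hdlo

/-- **`BSD_p` in analytic rank one at ANY odd additive prime from the two INDEX SOCKETS and the two HALVES of the
rank-zero twist — ROW-LOCAL** (the halves form of `bsdp_of_indexHalves_of_twist_row`: the partner enters through
`MissingLowerBoundAt Wd p` and `MissingUpperBoundAt Wd p` separately, so that a planner can feed the r = 0 lower half
(research) and the r = 0 upper half (often print: Kato's bound) from different sources). Terminal step kmc g17's
`SchneiderFree.Exact.bsdp_of_exactIndexManin_of_partner_halves`. CONDITIONAL; closes nothing.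
[cite: GrossZagier1986, I.(6.3) and Thm. I.7.3] [cite: JetchevSkinnerWan2017, §7.4.1 (arXiv:1512.06894 p. 30)]
[cite: FriedbergHoffstein1995, Thm. B] -/
theorem bsdp_of_indexHalves_of_twistHalves_row (p : ℕ) [Fact p.Prime] (hp2 : p ≠ 2) (hF : ToricPublishedInputs)
    (W : WeierstrassCurve ℚ) [W.IsElliptic] [W.IsGloballyMinimal] (haddv : Addv W p) (hr : W.analyticRank = 1)
    (hLoI : ∀ (N : ℕ) [NeZero N] (K : Type) [Field K] [NumberField K] (Dt : ModularParametrizationData W N)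
      (H : HeegnerDatum N (NumberField.discr K)) (ι : K →+* ℂ) (P : (W.baseChange K).toAffine.Point),
      W.conductorNorm ℤ = N → IsImaginaryQuadratic K → SatisfiesHeegnerHypothesis N K → Odd (NumberField.discr K) →
      NumberField.discr K < -4 → (W.quadraticTwist (NumberField.discr K : ℚ)).entireLFunction 1 ≠ 0 →
      WeierstrassCurve.Affine.Point.map ι.toRatAlgHom P = heegnerPointComplex Dt H → ¬ IsOfFinAddOrder P →
      SchneiderFree.IndexLowerBoundLeAt W p K P (padicValNat p Dt.c.natAbs))
    (hUpI : ∀ (N : ℕ) [NeZero N] (K : Type) [Field K] [NumberField K] (Dt : ModularParametrizationData W N)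
      (H : HeegnerDatum N (NumberField.discr K)) (ι : K →+* ℂ) (P : (W.baseChange K).toAffine.Point),
      W.conductorNorm ℤ = N → IsImaginaryQuadratic K → SatisfiesHeegnerHypothesis N K → Odd (NumberField.discr K) →
      NumberField.discr K < -4 → (W.quadraticTwist (NumberField.discr K : ℚ)).entireLFunction 1 ≠ 0 →
      WeierstrassCurve.Affine.Point.map ι.toRatAlgHom P = heegnerPointComplex Dt H → ¬ IsOfFinAddOrder P →
      SchneiderFree.Upper.IndexUpperBoundLeAt W p K P (padicValNat p Dt.c.natAbs))
    (hTwLo : ∀ (N : ℕ) [NeZero N] (K : Type) [Field K] [NumberField K]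
      (Wd : WeierstrassCurve ℚ) [Wd.IsElliptic] [Wd.IsGloballyMinimal],
      W.conductorNorm ℤ = N → IsImaginaryQuadratic K → SatisfiesHeegnerHypothesis N K →
      (∃ C : VariableChange ℚ, C • W.quadraticTwist (NumberField.discr K : ℚ) = Wd) →
      (W.quadraticTwist (NumberField.discr K : ℚ)).entireLFunction 1 ≠ 0 → MissingLowerBoundAt Wd p)
    (hTwUp : ∀ (N : ℕ) [NeZero N] (K : Type) [Field K] [NumberField K]
      (Wd : WeierstrassCurve ℚ) [Wd.IsElliptic] [Wd.IsGloballyMinimal],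
      W.conductorNorm ℤ = N → IsImaginaryQuadratic K → SatisfiesHeegnerHypothesis N K →
      (∃ C : VariableChange ℚ, C • W.quadraticTwist (NumberField.discr K : ℚ) = Wd) →
      (W.quadraticTwist (NumberField.discr K : ℚ)).entireLFunction 1 ≠ 0 → MissingUpperBoundAt Wd p) :
    BSDp W p := by
  have hp : p.Prime := Fact.out
  obtain ⟨hGZ, hKo, hGZK, hmod, hmodP, -, hGZ73, hFH, hpar, hHP⟩ := hF
  haveI hN0 : NeZero (W.conductorNorm ℤ) := ⟨W.conductorNorm_pos_holds.ne'⟩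
  have hw : W.rootNumber = -1 := by
    rcases W.rootNumber_eq_one_or with h | h
    · exfalso
      have heven : Even W.analyticRank := (hpar W).mpr h
      rw [hr] at heven
      exact Nat.not_even_one heven
    · exact h
  obtain ⟨K, _, _, hK, -, hHN, hH6, hLt⟩ := hFH W hw 6 (by norm_num) 0
  have hodd : Odd (NumberField.discr K) := by
    have h8 := Literature.SatisfiesHeegnerHypothesis.discr_emod_eight hK.1 hH6 (by norm_num : (2 : ℕ) ∣ 6)
    rw [Int.odd_iff]; omega
  have hd4 : NumberField.discr K < -4 :=
    discr_lt_neg_four_of_three_split hK (hH6 3 Nat.prime_three (by norm_num : (3 : ℕ) ∣ 6))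
  have hwK : ¬ p ∣ Units.torsionOrder K := by
    rw [Literature.NumberTheory.QuadraticFields.Quadratic.torsionOrder_eq_two_of_discr_lt_neg_four hK.1 hd4]
    intro h
    exact hp2 ((Nat.prime_dvd_prime_iff_eq hp Nat.prime_two).mp h)
  have hpN : p ∣ W.conductorNorm ℤ :=
    (W.dvd_conductorNorm_iff_not_hasGoodReductionAtPrime p).mpr (not_good_of_addv W p haddv)
  obtain ⟨P, Dt, H, ι, hP⟩ := hHP W K hK hHN
  have hL0 : W.entireLFunction 1 = 0 := entireLFunction_one_eq_zero_of_analyticRank_eq_one hr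
  obtain ⟨-, hderiv⟩ := leadingLCoeff_eq_deriv_of_analyticRank_eq_one hr
  have hLK : LDerivEK W K ≠ 0 := by
    rw [lDerivEK_eq_deriv_mul W K hmod hL0]; exact mul_ne_zero hderiv hLt
  have hnt : ¬ IsOfFinAddOrder P :=
    (lDerivEK_ne_zero_iff_not_isOfFinAddOrder W (W.conductorNorm ℤ) K (hGZ _ W K) hK hHN
      ⟨Dt, H, ι, hP⟩).mp hLK
  have hlo : SchneiderFree.IndexLowerBoundLeAt W p K P (padicValNat p Dt.c.natAbs) :=
    hLoI (W.conductorNorm ℤ) K Dt H ι P rfl hK hHN hodd hd4 hLt hP hnt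
  have hupI : SchneiderFree.Upper.IndexUpperBoundLeAt W p K P (padicValNat p Dt.c.natAbs) :=
    hUpI (W.conductorNorm ℤ) K Dt H ι P rfl hK hHN hodd hd4 hLt hP hnt
  have hD0 : (NumberField.discr K : ℚ) ≠ 0 := by exact_mod_cast NumberField.discr_ne_zero K
  haveI : (W.quadraticTwist (NumberField.discr K : ℚ)).IsElliptic := W.isElliptic_quadraticTwist hD0
  obtain ⟨Cd, hCd⟩ := hasGlobalMinimalModel_rat_holds (W.quadraticTwist (NumberField.discr K : ℚ))
  haveI : (Cd • W.quadraticTwist (NumberField.discr K : ℚ)).IsGloballyMinimal := hCd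
  have hdlo : MissingLowerBoundAt (Cd • W.quadraticTwist (NumberField.discr K : ℚ)) p :=
    hTwLo (W.conductorNorm ℤ) K (Cd • W.quadraticTwist (NumberField.discr K : ℚ)) rfl hK hHN ⟨Cd, rfl⟩ hLt
  have hdup : MissingUpperBoundAt (Cd • W.quadraticTwist (NumberField.discr K : ℚ)) p :=
    hTwUp (W.conductorNorm ℤ) K (Cd • W.quadraticTwist (NumberField.discr K : ℚ)) rfl hK hHN ⟨Cd, rfl⟩ hLt
  exact SchneiderFree.Exact.bsdp_of_exactIndexManin_of_partner_halves hGZ hKo hGZK hmod hGZ73 W p (W.conductorNorm ℤ) K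
    Dt H ι P (Cd • W.quadraticTwist (NumberField.discr K : ℚ)) hr rfl hpN hK hodd hwK hHN hLt hP ⟨Cd, rfl⟩ hp2 hlo hupI
    hdlo hdup

/-! ## §2 The r = 1 LOWER half from the Eisenstein ♭-inclusion + control + the twists' UPPER half -/

/-- **The r = 1 LOWER half `MissingLowerBoundAt W p` at ANY odd additive prime from the EISENSTEIN ♭-inclusion (X),
exact anticyclotomic control, Hsieh + LZZ (the value) and the r = 0 UPPER half of the twists — ROW-LOCAL.**
`= missingLowerBoundAt_of_indexLower_of_twistUpper_row ∘ indexLowerBoundLeAt_of_flatInclLe_of_control`. CONDITIONAL.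
[cite: JetchevSkinnerWan2017, §7.4.1 (arXiv:1512.06894 p. 30)] [cite: Hsieh2014, Thm. A p. 712 (Doc. Math. 19)]
[cite: LiuZhangZhang2018, Thm 1.5.1 and Thm 1.5.3 (Duke Math. J. 167 pp. 748–749)] [cite: GrossZagier1986, I.(6.3)] -/
theorem missingLowerBoundAt_of_flatEisenstein_of_control_of_twistUpper_row (p : ℕ) [Fact p.Prime] (hp2 : p ≠ 2)
    (hA : Hsieh2014.thmA_exists_isHsiehLFunction_unrPeriod_anyLevel)
    (hL : LiuZhangZhang2018.thm151_thm153_modularCurve_heegnerVector_additive)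
    (hF : ToricPublishedInputs)
    (W : WeierstrassCurve ℚ) [W.IsElliptic] [W.IsGloballyMinimal] (haddv : Addv W p) (hr : W.analyticRank = 1)
    (hIncl : ∀ (N : ℕ) [NeZero N] (K : Type) [Field K] [NumberField K] (Dt : ModularParametrizationData W N),
      W.conductorNorm ℤ = N → IsImaginaryQuadratic K → SatisfiesHeegnerHypothesis N K →
      ∀ (κ : ZpExtension K p), κ.IsAnticyclotomic → ∀ (γ : Field.absoluteGaloisGroup K) [Fact (κ.IsTopGenerator γ)]
        (𝔭 : HeightOneSpectrum (𝓞 K)), ((p : ℕ) : 𝓞 K) ∈ 𝔭.asIdeal → 𝔭.asIdeal.ramificationIdx (𝓞 ℚ) = 1 →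
        𝔭.asIdeal.inertiaDeg (𝓞 ℚ) = 1 → ∀ (𝔭' : HeightOneSpectrum (𝓞 K)), ((p : ℕ) : 𝓞 K) ∈ 𝔭'.asIdeal → 𝔭' ≠ 𝔭 →
        ∀ (ι' : PadicAlgCl p ≃+* ℂ), SchneiderFree.BranchInducesPrime p ι' 𝔭 →
        ∀ (ΩK : ℂ) (Ωp : ℂ_[p]) (Q : PowerSeries (PadicComplexInt p)), ΩK ≠ 0 → Ωp ≠ 0 →
          R1.IsBDPLFunctionInt p ι' 𝔭 κ γ Dt.f ΩK Ωp Q →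
          (XAc.charIdeal (W.baseChange K) p κ 𝔭' ∅ γ).map (PowerSeries.map (R1.toCpInt p)) ≤ Ideal.span {Q})
    (hCtl : ∀ (N : ℕ) [NeZero N] (K : Type) [Field K] [NumberField K] (Dt : ModularParametrizationData W N)
      (H : HeegnerDatum N (NumberField.discr K)) (ι : K →+* ℂ) (P : (W.baseChange K).toAffine.Point),
      W.conductorNorm ℤ = N → IsImaginaryQuadratic K → SatisfiesHeegnerHypothesis N K →
      (W.quadraticTwist (NumberField.discr K : ℚ)).entireLFunction 1 ≠ 0 →
      WeierstrassCurve.Affine.Point.map ι.toRatAlgHom P = heegnerPointComplex Dt H → ¬ IsOfFinAddOrder P →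
      Literature.NumberTheory.EllipticCurves.kolyvagin N W K →
      ∀ (κ : ZpExtension K p), κ.IsAnticyclotomic → ∀ (γ : Field.absoluteGaloisGroup K) [Fact (κ.IsTopGenerator γ)]
        (𝔭 : HeightOneSpectrum (𝓞 K)) (h𝔭 : ((p : ℕ) : 𝓞 K) ∈ 𝔭.asIdeal) (he : 𝔭.asIdeal.ramificationIdx (𝓞 ℚ) = 1)
        (hf : 𝔭.asIdeal.inertiaDeg (𝓞 ℚ) = 1),
        SchneiderFree.AdditiveControlOnTreeAt p κ 𝔭 γ (embAt K p 𝔭 h𝔭 he hf) P)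
    (hTwUp : ∀ (N : ℕ) [NeZero N] (K : Type) [Field K] [NumberField K]
      (Wd : WeierstrassCurve ℚ) [Wd.IsElliptic] [Wd.IsGloballyMinimal],
      W.conductorNorm ℤ = N → IsImaginaryQuadratic K → SatisfiesHeegnerHypothesis N K →
      (∃ C : VariableChange ℚ, C • W.quadraticTwist (NumberField.discr K : ℚ) = Wd) →
      (W.quadraticTwist (NumberField.discr K : ℚ)).entireLFunction 1 ≠ 0 → MissingUpperBoundAt Wd p) :
    MissingLowerBoundAt W p := by
  have hKo : ∀ (N : ℕ) [NeZero N] (W : WeierstrassCurve ℚ) (K : Type) [Field K] [NumberField K],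
      Literature.NumberTheory.EllipticCurves.kolyvagin N W K := hF.2.1
  refine missingLowerBoundAt_of_indexLower_of_twistUpper_row p hp2 hF W haddv hr ?_ hTwUp
  intro N _ K _ _ Dt H ι P hN hK hHN _hodd hd4 hLt hP hnt
  exact indexLowerBoundLeAt_of_flatInclLe_of_control hp2 hA hL Dt H ι P haddv hN hK hHN hd4 hP hnt (hKo N W K)
    (fun κ hκ γ _ 𝔭 h𝔭 he hf 𝔭' h𝔭' hne ι' hind ΩK Ωp Q hΩK hΩp hBDP ↦
      hIncl N K Dt hN hK hHN κ hκ γ 𝔭 h𝔭 he hf 𝔭' h𝔭' hne ι' hind ΩK Ωp Q hΩK hΩp hBDP)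
    (fun κ hκ γ _ 𝔭 h𝔭 he hf ↦ hCtl N K Dt H ι P hN hK hHN hLt hP hnt (hKo N W K) κ hκ γ 𝔭 h𝔭 he hf)

/-! ## §3 Potentially supersingular rows: the r = 1 LOWER half with control discharged -/

/-- **The r = 1 LOWER half at EVERY odd additive potentially SUPERSINGULAR prime of an X4 curve from the EISENSTEIN
♭-inclusion and the twists' r = 0 UPPER half, local step DISCHARGED.** For any row predicate `R`: on the rows `R W`,
`ClassO5 W p ∨ ClassO6 W p`, `ρ̄_{E,p}` irreducible, `r_an = 1`: `MissingLowerBoundAt W p` ⟸ Hsieh ∧ LZZ ∧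
ToricPublishedInputs ∧ {Poitou–Tate ×2, local Euler–Poincaré, cd ≤ 2, Brink Thm 2 / Cor 1, Serre 1967} ∧ `hIncl` (X on
the class rows — RESEARCH; at the wild `3` = route SOED's crux `WildSplitEisensteinInclusionAtThree` in ♭-currency) ∧
`hTwUp` (`MissingUpperBoundAt` of globally minimal models of the rank-zero twists of class rows — at the wild `3` K9's
U₀, derived). CONDITIONAL; closes nothing; BSD_p for no curve.
[cite: JetchevSkinnerWan2017, §7.4.1 and Thm. 3.3.1 (arXiv:1512.06894)] [cite: Hsieh2014, Thm. A p. 712 (Doc. Math. 19)]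
[cite: LiuZhangZhang2018, Thm 1.5.1 and Thm 1.5.3 (Duke Math. J. 167 pp. 748–749)] [cite: Brink2007, Thm. 2 and Cor. 1]
[cite: Serre1967GroupesPDivisibles, §5 Prop. 8] [cite: GrossZagier1986, I.(6.3)] -/
theorem missingLowerBoundAt_potSS_rankOne_of_flatEisenstein_of_twistUpper_of_facts (p : ℕ) [Fact p.Prime]
    (R : WeierstrassCurve ℚ → Prop)
    (hA : Hsieh2014.thmA_exists_isHsiehLFunction_unrPeriod_anyLevel)
    (hL : LiuZhangZhang2018.thm151_thm153_modularCurve_heegnerVector_additive)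
    (hF : ToricPublishedInputs)
    (hPT : ∀ (K : Type) [Field K] [NumberField K], poitouTate_selmerStructure_duality K)
    (hPT2 : ∀ (K : Type) [Field K] [NumberField K], poitouTate_sha_tateDual K)
    (hEP : ∀ (K : Type) [Field K] [NumberField K] (v : HeightOneSpectrum (𝓞 K)),
      localEulerPoincareCharacteristic (v.adicCompletion K))
    (hcd : fieldCdLE_two_of_numberField)
    (hBr : ∀ (K : Type) [Field K] [NumberField K] (p : ℕ) [Fact p.Prime],
      ZpExtension.decomp_not_le_kerSubgroup_of_isAnticyclotomic K p)
    (hBr2 : ∀ (K : Type) [Field K] [NumberField K] (p : ℕ) [Fact p.Prime],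
      ZpExtension.decomp_not_le_kerSubgroup_above_of_isAnticyclotomic K p)
    (hS : Serre1967.noStableDivisibleLine_of_potentiallySupersingular)
    (hIncl : ∀ (W : WeierstrassCurve ℚ) [W.IsElliptic] [W.IsGloballyMinimal] (N : ℕ) [NeZero N] (K : Type) [Field K]
      [NumberField K] (Dt : ModularParametrizationData W N),
      R W → (ClassO5 W p ∨ ClassO6 W p) → W.HasIrreducibleModPGaloisRep p → W.analyticRank = 1 → W.conductorNorm ℤ = N →
      IsImaginaryQuadratic K → SatisfiesHeegnerHypothesis N K →
      ∀ (κ : ZpExtension K p), κ.IsAnticyclotomic → ∀ (γ : Field.absoluteGaloisGroup K) [Fact (κ.IsTopGenerator γ)]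
        (𝔭 : HeightOneSpectrum (𝓞 K)), ((p : ℕ) : 𝓞 K) ∈ 𝔭.asIdeal → 𝔭.asIdeal.ramificationIdx (𝓞 ℚ) = 1 →
        𝔭.asIdeal.inertiaDeg (𝓞 ℚ) = 1 → ∀ (𝔭' : HeightOneSpectrum (𝓞 K)), ((p : ℕ) : 𝓞 K) ∈ 𝔭'.asIdeal → 𝔭' ≠ 𝔭 →
        ∀ (ι' : PadicAlgCl p ≃+* ℂ), SchneiderFree.BranchInducesPrime p ι' 𝔭 →
        ∀ (ΩK : ℂ) (Ωp : ℂ_[p]) (Q : PowerSeries (PadicComplexInt p)), ΩK ≠ 0 → Ωp ≠ 0 →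
          R1.IsBDPLFunctionInt p ι' 𝔭 κ γ Dt.f ΩK Ωp Q →
          (XAc.charIdeal (W.baseChange K) p κ 𝔭' ∅ γ).map (PowerSeries.map (R1.toCpInt p)) ≤ Ideal.span {Q})
    (hTwUp : ∀ (W : WeierstrassCurve ℚ) [W.IsElliptic] [W.IsGloballyMinimal] (N : ℕ) [NeZero N] (K : Type) [Field K]
      [NumberField K] (Wd : WeierstrassCurve ℚ) [Wd.IsElliptic] [Wd.IsGloballyMinimal],
      R W → (ClassO5 W p ∨ ClassO6 W p) → W.HasIrreducibleModPGaloisRep p → W.analyticRank = 1 → W.conductorNorm ℤ = N →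
      IsImaginaryQuadratic K → SatisfiesHeegnerHypothesis N K →
      (∃ C : VariableChange ℚ, C • W.quadraticTwist (NumberField.discr K : ℚ) = Wd) →
      (W.quadraticTwist (NumberField.discr K : ℚ)).entireLFunction 1 ≠ 0 → MissingUpperBoundAt Wd p) :
    ∀ (W : WeierstrassCurve ℚ) [W.IsElliptic] [W.IsGloballyMinimal],
      R W → (ClassO5 W p ∨ ClassO6 W p) → W.HasIrreducibleModPGaloisRep p → W.analyticRank = 1 →
        MissingLowerBoundAt W p := by
  intro W _ _ hR hcls hirr hr
  have hp2 : p ≠ 2 := hcls.elim (fun h ↦ h.1) (fun h ↦ h.1)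
  have haddv : Addv W p := hcls.elim (fun h ↦ h.2.1) (fun h ↦ h.2.1)
  exact missingLowerBoundAt_of_flatEisenstein_of_control_of_twistUpper_row p hp2 hA hL hF W haddv hr
    (fun N _ K _ _ Dt hN hK hHN κ hκ γ _ 𝔭 h𝔭 he hf 𝔭' h𝔭' hne ι' hind ΩK Ωp Q hΩK hΩp hBDP ↦
      hIncl W N K Dt hR hcls hirr hr hN hK hHN κ hκ γ 𝔭 h𝔭 he hf 𝔭' h𝔭' hne ι' hind ΩK Ωp Q hΩK hΩp hBDP)
    (fun N _ K _ _ Dt H ι P hN hK hHN _hLt hP hnt hKo κ hκ γ _ 𝔭 h𝔭 he hf ↦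
      additiveControl_heegner_potSS_of_facts_of_serre1967 hPT hPT2 hEP hcd hBr hBr2 hS p W N K Dt H ι P hcls hirr
        hN hK hHN hP hnt hKo κ hκ γ 𝔭 h𝔭 he hf)
    (fun N _ K _ _ Wd _ _ hN hK hHN hC hLt ↦ hTwUp W N K Wd hR hcls hirr hr hN hK hHN hC hLt)

end Summit.BirchSwinnertonDyer.BirchSwinnertonDyer.Theorems.UniversalToricDescentWaldspurgerFlat

end
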